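import Summits.QuantumFields.YangMills.Theorems.LuscherReductionTwistedTraceScalingBOStiffSepBased
import Summits.QuantumFields.YangMills.Theorems.TwistedTraceScaling.Negative.AvgKernelStiffFlip
import Summits.QuantumFields.YangMills.Theorems.LuscherReductionTwistedTraceScalingRecordWeightConj
import Summits.QuantumFields.YangMills.Theorems.LuscherReductionTwistedTraceScalingBTColourFP
import Summits.QuantumFields.YangMills.Theorems.FlatTubeReductionFPLevelSetVolume
import Summits.QuantumFields.YangMills.Theorems.FlatTubeReductionFarPairKernels
import Summits.QuantumFields.YangMills.Theorems.LuscherReductionDressedRitzPolyakovLiftTransplantDilation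
import HarnessLib

/-!
# (C5-α) ★★★ STIFF SEPARATION: two tube points separated in the fibre by more than the bootstrap error are kinetically separated along the WHOLE gauge orbit; hence
# `K̃_β(U', V) ≤ e^{2β|E|}·e^{−β d²}`
# (lane A of S-BASE, crux `TwistedTraceScaling` stmt-QuantumFields-20203, C4-CORE, the (OD) pen; `pub/ym-fleet/ym-luscher-20007-p1/Lines-stiff-separation.md` §4)

The colour reduction (S2) on top of `…BOStiffSepBased.stiffSep_based`: for an ARBITRARY gauge field `g` with `kinDefect (oT u' x') (oT u x) g ≤ d²`, the based field `η = g₀⁻¹g` is within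
`ϑ = 3L(d + a' + a)` of `1` (`…BOStiffSepJumps`), `kinDefect U' V g = kinDefect (g₀⁻¹U'g₀) V η` (`kinDefect_const_mul`) and `g₀⁻¹(oT u' x')g₀ = oT (g₀⁻¹u'g₀) (Ad_{g₀⁻¹}x')`
(`R33.gaugeTransform_const_orthoTube`) with ALL hypotheses on `(u', x')` invariant (`‖x̂'‖`, `‖P_Γx̂'‖` by `starProjection_adL`, the cap, the slow amplitudes); then `η = chartSU2∘ζ`
with `ζ 0 = 0`, `‖ζ_y‖∞ ≤ ϑ`:
* ★★★ `stiffSep_radius_le` — `kinDefect ≤ d²` ⇒ `‖x̂'‖² ≤ τ² + (‖x̂‖ + 4τ + 4·Y(2g₁,g₁))²` (the explicit bootstrap bound of `stiffSep_based` with `ϑ = 3L(d+a'+a)`), for EVERY `g`;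
* ★★★ `avgKernel_le_of_stiffSep` — contrapositive + `transferKernel_gaugeTransform_le` + `avgKernel_le_of_forall_gauge`: if `‖x̂'‖²` EXCEEDS that bound then
  `K̃_β(oT u' x', oT u x) ≤ e^{2β|E|}·e^{−βd²}` — the hypothesis `hsep` of `…BODefectOutPiece.out_sq_integral_le_of_sep` with `K_sep = e^{2β|E|}e^{−βd²}`, at every `U'` of the
  outer region and `V` of the inner tube once the schedule makes the bound `< (r_f/12)²` with `d ≍ r_f` (next seat: the eventual bookkeeping).
HONEST FRAMING: the analytic core of (C5) for a stub of a child of the CONDITIONAL route R2b1; the schedule instance of (SEP), the hOD assembly, (B-ST), C4-CORE OPEN; not infinite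
volume, not a gap, not Clay.
-/

set_option autoImplicit false

noncomputable section

open Real
open scoped BigOperators Matrix Quaternion RealInnerProductSpace
open Literature.MathematicalPhysics.QuantumFieldTheory
open Literature.MathematicalPhysics.QuantumLattice

namespace Summit.QuantumFields.YangMills.Theorems.FemtoTransferGap.TwoLattice.ConstTube

open Summit.QuantumFields.YangMills.Theorems.FemtoTransferGap
open Summit.QuantumFields.YangMills.Theorems.FemtoTransferGap.TwoLattice
open Summit.QuantumFields.YangMills.Theorems.FemtoTransferGap.TwoLattice.Avg
open Summit.QuantumFields.YangMills.Theorems.FemtoTransferGap.TwoLattice.Stiff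
open Summit.QuantumFields.YangMills.Theorems.FemtoTransferGap.TwoLattice.Toron
open Summit.QuantumFields.YangMills.Theorems.FemtoTransferGap.TwoLattice.Cov
open Summit.QuantumFields.YangMills.Theorems.TwistedTraceScaling.Negative.R33 (gaugeTransform_const_orthoTube)
open Summit.QuantumFields.YangMills.Theorems.TwistedTraceScaling.Negative.R45 (norm_su2Quat_inv_sub_one)

variable {L : ℕ} [NeZero L]

/-- ★★★ **STIFF SEPARATION, RADIUS FORM** (every gauge field `g`).  See the module docstring; `ϑ := 3L(d + a' + a)`,
`Y(G,G_m) := √6·d + √(6|E|)((40(4G² + 2Gω) + 12τ_uG_m) + 4(6G + 2ω)m)`, `g₁ := 2C_P(2τ + Y(ϑ,ϑ))`. [cite: Luscher1983, §3] -/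
theorem stiffSep_radius_le {u u' : GaugeConfig 3 1 SU2} {x x' : Edge 3 L → Fin 3 → ℝ} (hx : x ∈ capBalancedSet L) (hx' : x' ∈ capBalancedSet L) (g : Site 3 L → SU2)
    {a a' ω τu τ C m d : ℝ} (ha' : ∀ e, ‖su2Quat (orthoTube L u' x' e) - 1‖ ≤ a') (ha : ∀ e, ‖su2Quat (orthoTube L u x e) - 1‖ ≤ a)
    (hω : ∀ e, ‖x e‖ ≤ ω) (hω1 : ω ≤ 1 / 20) (hτ1 : τu ≤ 1) (hu : ∀ (k : Fin 3) (c : Fin 3), |vecPart (u (0, k)) c| ≤ τu)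
    (hC : 0 < C) (hP : ∀ ξ : Site 3 L → Fin 3 → ℝ, ∑ y : Site 3 L, ξ y = 0 → ‖ξ‖ ≤ C * ‖vacGrad L ξ‖) (hsmall : 12 * Real.sqrt (3 * Fintype.card (Edge 3 L)) * τu * C ≤ 1 / 2)
    (hm : ∀ k : Fin 3, ‖su2Quat (u (0, k)) - 1‖ + ‖su2Quat (u' (0, k)) - 1‖ ≤ m)
    (hτx' : ‖(gaugeModes L).starProjection (linkEmbed L x')‖ ≤ τ) (hτx : ‖(gaugeModes L).starProjection (linkEmbed L x)‖ ≤ τ)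
    (hd : 0 ≤ d) (hK : kinDefect L (orthoTube L u' x') (orthoTube L u x) g ≤ d ^ 2) (hϑ1 : 3 * L * (d + a' + a) ≤ 1 / 40)
    (hg₁ : 2 * (2 * C * (2 * τ + (Real.sqrt 6 * d + Real.sqrt (6 * Fintype.card (Edge 3 L)) *
      ((40 * (4 * (3 * L * (d + a' + a)) ^ 2 + 2 * (3 * L * (d + a' + a)) * ω) + 12 * τu * (3 * L * (d + a' + a))) + 4 * (6 * (3 * L * (d + a' + a)) + 2 * ω) * m)))) ≤ 1 / 40) :
    ‖linkEmbed L x'‖ ^ 2 ≤ τ ^ 2 + (‖linkEmbed L x‖ + 4 * τ + 4 * (Real.sqrt 6 * d + Real.sqrt (6 * Fintype.card (Edge 3 L)) *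
      ((40 * (4 * (2 * (2 * C * (2 * τ + (Real.sqrt 6 * d + Real.sqrt (6 * Fintype.card (Edge 3 L)) * ((40 * (4 * (3 * L * (d + a' + a)) ^ 2 + 2 * (3 * L * (d + a' + a)) * ω) + 12 * τu * (3 * L * (d + a' + a))) + 4 * (6 * (3 * L * (d + a' + a)) + 2 * ω) * m))))) ^ 2 +
          2 * (2 * (2 * C * (2 * τ + (Real.sqrt 6 * d + Real.sqrt (6 * Fintype.card (Edge 3 L)) * ((40 * (4 * (3 * L * (d + a' + a)) ^ 2 + 2 * (3 * L * (d + a' + a)) * ω) + 12 * τu * (3 * L * (d + a' + a))) + 4 * (6 * (3 * L * (d + a' + a)) + 2 * ω) * m))))) * ω) +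
        12 * τu * (2 * C * (2 * τ + (Real.sqrt 6 * d + Real.sqrt (6 * Fintype.card (Edge 3 L)) * ((40 * (4 * (3 * L * (d + a' + a)) ^ 2 + 2 * (3 * L * (d + a' + a)) * ω) + 12 * τu * (3 * L * (d + a' + a))) + 4 * (6 * (3 * L * (d + a' + a)) + 2 * ω) * m))))) +
        4 * (6 * (2 * (2 * C * (2 * τ + (Real.sqrt 6 * d + Real.sqrt (6 * Fintype.card (Edge 3 L)) * ((40 * (4 * (3 * L * (d + a' + a)) ^ 2 + 2 * (3 * L * (d + a' + a)) * ω) + 12 * τu * (3 * L * (d + a' + a))) + 4 * (6 * (3 * L * (d + a' + a)) + 2 * ω) * m))))) + 2 * ω) * m))) ^ 2 := by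
  have hmul := @Literature.MathematicalPhysics.QuantumFieldTheory.Balaban1983to89.T4HaarSU2Translate.su2Quat_mul
  -- the colour factor and the based field
  set c : SU2 := g 0 with hc
  set η : Site 3 L → SU2 := fun y => c⁻¹ * g y with hη
  have hgη : g = fun y => c * η y := funext fun y => by rw [hη]; dsimp only; rw [mul_inv_cancel_left]
  have hη1 : ∀ y, ‖su2Quat (η y) - 1‖ ≤ 3 * L * (d + a' + a) := fun y => norm_based_sub_one_le_of_kinDefect_le hd hK ha' ha y
  -- its chart parameter
  set ζ : Site 3 L → Fin 3 → ℝ := fun y => vecPart (η y) with hζ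
  have hsc : ∀ y, 0 ≤ scalarPart (η y) := fun y => by
    have h := one_sub_scalarPart_le_norm_sub_one (η y); linarith [hη1 y]
  have hηζ : η = fun y => chartSU2 (ζ y) := funext fun y => (chartSU2_vecPart (η y) (hsc y)).symm
  have hζ0 : ζ 0 = 0 := by rw [hζ]; dsimp only; rw [hη]; dsimp only; rw [hc, inv_mul_cancel]; exact PolyakovLift.vecPart_one
  have hϑ : ∀ y, ‖ζ y‖ ≤ 3 * L * (d + a' + a) := fun y =>
    (pi_norm_le_iff_of_nonneg ((norm_nonneg _).trans (hη1 y))).mpr fun c' => by rw [Real.norm_eq_abs]; exact (abs_vecPart_le_norm_sub_one _ c').trans (hη1 y)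
  -- the conjugated first point
  have hx'1 : ∀ e, ∑ a, x' e a ^ 2 ≤ 1 := fun e => (hx'.2 e).trans (by norm_num)
  have hconj : gaugeTransform (fun _ : Site 3 L => c⁻¹) (orthoTube L u' x') =
      orthoTube L (gaugeTransform (fun _ : Site 3 1 => c⁻¹) u') (colourRotate L (fun _ => c⁻¹) x') := gaugeTransform_const_orthoTube c⁻¹ u' hx'1
  have hK' : kinDefect L (orthoTube L (gaugeTransform (fun _ : Site 3 1 => c⁻¹) u') (colourRotate L (fun _ => c⁻¹) x')) (orthoTube L u x) (fun y => chartSU2 (ζ y)) ≤ d ^ 2 := by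
    rw [← hηζ, ← hconj, ← kinDefect_const_mul, ← hgη]; exact hK
  -- invariance of the hypotheses
  have hxr : colourRotate L (fun _ => c⁻¹) x' ∈ capBalancedSet L := colourRotate_mem_capBalancedSet L hx'
  have hnorm : ‖linkEmbed L (colourRotate L (fun _ => c⁻¹) x')‖ = ‖linkEmbed L x'‖ := by rw [linkEmbed_colourRotate_const]; exact LinearIsometryEquiv.norm_map _ _
  have hτr : ‖(gaugeModes L).starProjection (linkEmbed L (colourRotate L (fun _ => c⁻¹) x'))‖ ≤ τ := by
    rw [linkEmbed_colourRotate_const, starProjection_adL, LinearIsometryEquiv.norm_map]; exact hτx'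
  have hmr : ∀ k : Fin 3, ‖su2Quat (u (0, k) * (gaugeTransform (fun _ : Site 3 1 => c⁻¹) u' (0, k))⁻¹) - 1‖ ≤ m := by
    intro k
    have e : gaugeTransform (fun _ : Site 3 1 => c⁻¹) u' (0, k) = c⁻¹ * u' (0, k) * c := by
      show c⁻¹ * u' (0, k) * c⁻¹⁻¹ = _; rw [inv_inv]
    rw [e]
    calc ‖su2Quat (u (0, k) * (c⁻¹ * u' (0, k) * c)⁻¹) - 1‖ ≤ ‖su2Quat (u (0, k)) - 1‖ + ‖su2Quat (c⁻¹ * u' (0, k) * c)⁻¹ - 1‖ := RateTube.norm_su2Quat_mul_sub_one_le _ _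
      _ = ‖su2Quat (u (0, k)) - 1‖ + ‖su2Quat (u' (0, k)) - 1‖ := by rw [norm_su2Quat_inv_sub_one, RateTube.norm_su2Quat_conj_sub_one]
      _ ≤ m := hm k
  have h := stiffSep_based (L := L) hx hxr hζ0 hϑ hϑ1 hω hω1 hτ1 hu hC hP hsmall hmr hτr hτx hd hK' hg₁
  rw [hnorm] at h
  exact h

set_option maxHeartbeats 800000 in
-- the explicit two-round bootstrap radius in the statement is ~1.5k characters; elaborating the contrapositive exceeds the default budget.
/-- ★★★ **STIFF SEPARATION, KERNEL FORM**: if `‖x̂'‖²` exceeds the bootstrap radius of `stiffSep_radius_le` at threshold `d`, then EVERY gauge copy of `oT u x` is kinetically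
`d²`-far from `oT u' x'`, hence `K̃_β(oT u' x', oT u x) ≤ e^{2β|E|}·e^{−β d²}` (`β ≥ 0`). [cite: Luscher1983, §3] -/
theorem avgKernel_le_of_stiffSep {β : ℝ} (hβ : 0 ≤ β) {u u' : GaugeConfig 3 1 SU2} {x x' : Edge 3 L → Fin 3 → ℝ} (hx : x ∈ capBalancedSet L) (hx' : x' ∈ capBalancedSet L)
    {a a' ω τu τ C m d : ℝ} (ha' : ∀ e, ‖su2Quat (orthoTube L u' x' e) - 1‖ ≤ a') (ha : ∀ e, ‖su2Quat (orthoTube L u x e) - 1‖ ≤ a)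
    (hω : ∀ e, ‖x e‖ ≤ ω) (hω1 : ω ≤ 1 / 20) (hτ1 : τu ≤ 1) (hu : ∀ (k : Fin 3) (c : Fin 3), |vecPart (u (0, k)) c| ≤ τu)
    (hC : 0 < C) (hP : ∀ ξ : Site 3 L → Fin 3 → ℝ, ∑ y : Site 3 L, ξ y = 0 → ‖ξ‖ ≤ C * ‖vacGrad L ξ‖) (hsmall : 12 * Real.sqrt (3 * Fintype.card (Edge 3 L)) * τu * C ≤ 1 / 2)
    (hm : ∀ k : Fin 3, ‖su2Quat (u (0, k)) - 1‖ + ‖su2Quat (u' (0, k)) - 1‖ ≤ m)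
    (hτx' : ‖(gaugeModes L).starProjection (linkEmbed L x')‖ ≤ τ) (hτx : ‖(gaugeModes L).starProjection (linkEmbed L x)‖ ≤ τ)
    (hd : 0 ≤ d) (hϑ1 : 3 * L * (d + a' + a) ≤ 1 / 40)
    (hg₁ : 2 * (2 * C * (2 * τ + (Real.sqrt 6 * d + Real.sqrt (6 * Fintype.card (Edge 3 L)) *
      ((40 * (4 * (3 * L * (d + a' + a)) ^ 2 + 2 * (3 * L * (d + a' + a)) * ω) + 12 * τu * (3 * L * (d + a' + a))) + 4 * (6 * (3 * L * (d + a' + a)) + 2 * ω) * m)))) ≤ 1 / 40)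
    (hfar : τ ^ 2 + (‖linkEmbed L x‖ + 4 * τ + 4 * (Real.sqrt 6 * d + Real.sqrt (6 * Fintype.card (Edge 3 L)) *
      ((40 * (4 * (2 * (2 * C * (2 * τ + (Real.sqrt 6 * d + Real.sqrt (6 * Fintype.card (Edge 3 L)) * ((40 * (4 * (3 * L * (d + a' + a)) ^ 2 + 2 * (3 * L * (d + a' + a)) * ω) + 12 * τu * (3 * L * (d + a' + a))) + 4 * (6 * (3 * L * (d + a' + a)) + 2 * ω) * m))))) ^ 2 +
          2 * (2 * (2 * C * (2 * τ + (Real.sqrt 6 * d + Real.sqrt (6 * Fintype.card (Edge 3 L)) * ((40 * (4 * (3 * L * (d + a' + a)) ^ 2 + 2 * (3 * L * (d + a' + a)) * ω) + 12 * τu * (3 * L * (d + a' + a))) + 4 * (6 * (3 * L * (d + a' + a)) + 2 * ω) * m))))) * ω) +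
        12 * τu * (2 * C * (2 * τ + (Real.sqrt 6 * d + Real.sqrt (6 * Fintype.card (Edge 3 L)) * ((40 * (4 * (3 * L * (d + a' + a)) ^ 2 + 2 * (3 * L * (d + a' + a)) * ω) + 12 * τu * (3 * L * (d + a' + a))) + 4 * (6 * (3 * L * (d + a' + a)) + 2 * ω) * m))))) +
        4 * (6 * (2 * (2 * C * (2 * τ + (Real.sqrt 6 * d + Real.sqrt (6 * Fintype.card (Edge 3 L)) * ((40 * (4 * (3 * L * (d + a' + a)) ^ 2 + 2 * (3 * L * (d + a' + a)) * ω) + 12 * τu * (3 * L * (d + a' + a))) + 4 * (6 * (3 * L * (d + a' + a)) + 2 * ω) * m))))) + 2 * ω) * m))) ^ 2 <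
      ‖linkEmbed L x'‖ ^ 2) :
    avgKernel β (orthoTube L u' x') (orthoTube L u x) ≤ Real.exp (2 * β) ^ Fintype.card (Edge 3 L) * Real.exp (-(β * d ^ 2)) := by
  refine avgKernel_le_of_forall_gauge β _ _ fun g => ?_
  have hKg : d ^ 2 ≤ kinDefect L (orthoTube L u' x') (orthoTube L u x) g := by
    refine le_of_not_gt fun h => ?_
    have hr := stiffSep_radius_le (L := L) hx hx' g ha' ha hω hω1 hτ1 hu hC hP hsmall hm hτx' hτx hd h.le hϑ1 hg₁
    exact absurd (hr.trans_lt hfar) (lt_irrefl _)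
  refine (transferKernel_gaugeTransform_le (L := L) hβ _ _ g).trans ?_
  rw [← Real.exp_nat_mul, ← Real.exp_add]
  apply Real.exp_le_exp.2
  have h := mul_le_mul_of_nonneg_left hKg hβ
  linarith

end Summit.QuantumFields.YangMills.Theorems.FemtoTransferGap.TwoLattice.ConstTube

end
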